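import Summits.BirchSwinnertonDyer.BirchSwinnertonDyer.Theorems.EisensteinPrimesSurLambdaDualSelmerTower
import Summits.BirchSwinnertonDyer.BirchSwinnertonDyer.Theorems.EisensteinPrimesSurLambdaFiniteLevelLift
import Literature.NumberTheory.GaloisRepresentations.TateDualLimitLevelSelmerStructures
import Literature.NumberTheory.IwasawaTheory.Greenberg2016.LambdaTorsionLayers
import Literature.NumberTheory.IwasawaTheory.Greenberg2016.CoefficientLevels
import HarnessLib

/-!
# Road «SUR-Λ» (crux 2 `GoodLatticeBDPValue`, by-name input #9 `Greenberg2016.prop263_sur_of_crk`),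
# brick C6c: ASSEMBLY of step (ε) of Greenberg 2010 Prop. 3.2.1 — «every thread of the dual Selmer
# tower is zero ⟹ SUR(𝐃, 𝓛)»

Cell `bsd-eis`, width seat `bsd-line-x1-p1-w2` (gen 10); helper for stmt-BirchSwinnertonDyer-19032
(`--supports`), road memo `SUR-LAMBDA-ROAD-w5g9.md` §2 ★(ε), §7.4 C6.  ONE THEOREM (no definition, no
named fact, no `sorry`).

MATHEMATICS (R. Greenberg, *Surjectivity of the global-to-local map defining a Selmer group*, Kyoto
J. Math. 50 (2010), proof of Prop. 3.2.1, p. 15, with Prop. 3.1.1, p. 14): `𝐃` a discrete `Λ`-module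
with a continuous `Λ`-linear action `ρ` of `Gal(K_Σ/K)`, exhausted by finite stable levels
`N k = 𝐃[𝔪ᵏ]` (`p^k · N k = 0`); `𝓛` a specification; `T* = lim_k Hom(N k, μ_{p^k})`.  "Now assume that
`S_{𝓛*}(K, T*) = 0`" — in the tree's tower currency: EVERY compatible thread `(y_m)_{m ≥ m₀}` of classes
`y_m ∈ H¹_{𝓕_m^*}(K, Hom(N m, μ_{p^m}))` (dual Selmer groups of the level conditions `𝓕_m` = preimages
of `L(K_v, 𝐃)` on `Σ`, unramified off `Σ`, for THE canonical local invariants) is zero —; "it follows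
that `φ_𝓛` is surjective": given `q ∈ Q_𝓛(K, 𝐃)`, (1) represent its coordinates by local classes
`t_v ∈ H¹(K_v, 𝐃)`, `v ∈ Σ`, all coming from ONE finite level `N i` (`Γ_{K_v}` compact, `Σ` finite:
the tree's `exists_level_forall_localHmap_eq`, B3); (2) by the Kőnig step
(`SurLambda.exists_level_obstruction_eq_zero`, C6b) the Poitou–Tate obstruction
`y ↦ ∑_{v ∈ Σ} ⟨ι_* t_v, loc_v y⟩_{p^m}` vanishes identically on `H¹_{𝓕_m^*}` at some level `m ≥ i`;
(3) by the finite-level Poitou–Tate lift (`SurLambda.exists_phi_eq_of_level`, C6a: Milne I 4.10 (b) /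
Howard 2.1.11 for the finite module `N m`, through the `G_Σ`/`Γ_K` bridge) there is
`x ∈ H¹(K_Σ/K, 𝐃)` with `φ_𝓛(x) = q`.

* **`sur_of_forall_threads_eq_zero`** — the implication «all threads of the canonical dual Selmer
  tower of (`lambdaTorsionLayers S ρ p N …`, `levelSelmerStructure (specSelmerStructure S ρ L) T`)
  from every level `m₀` on are zero ⟹ `L.SUR`», for `Σ = T ⊇ Ω_∞` with `T ∩ {finite} = S ∋ {v ∣ p}`.

What is NOT here (next brick, after C5c): the translation «`S_{𝓛*}(K, T*) = 0` in the `Λ`-adic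
currency of `TateDualLimitLocalPairing.lean` (`limitPairing`, `dualLocalCondition`, `locDual`) ⟹ the
thread hypothesis» (`TorsionLayers.continuousCohomologyOneEquiv` + cofinality), and Greenberg's
deduction of `S_{𝓛*}(K, T*) = 0` from CRK + `𝓛` almost divisible (Prop. 3.2.1 (α)–(δ), other seats).

HONEST FRAMING: a helper; closes no stub; no case of Greenberg's Prop. 2.6.3 / 3.2.1 beyond the
displayed implication, of Poitou–Tate duality beyond the tree theorems invoked, or of BSD is proved
here; no summit statement is proved.
References: [Greenberg2010] §2 p. 6, Prop. 3.1.1 (p. 14), Prop. 3.2.1 (p. 15); [Greenberg2016Selmer]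
§1 p. 3, Prop. 2.6.3; [MilneADT2006] I Thm. 4.10 (b); [SerreGaloisCohomology1997] I §2.2 Prop. 8.
-/

set_option autoImplicit false
set_option linter.dupNamespace false

noncomputable section

open CategoryTheory Function NumberField IsDedekindDomain Field
open scoped NumberField ContRepresentation

namespace Summit.BirchSwinnertonDyer.BirchSwinnertonDyer.Theorems.SurLambda

open Literature.NumberTheory.GaloisRepresentations Literature.NumberTheory.GaloisCohomology
open Literature.NumberTheory.GaloisRepresentations.DiscreteGaloisModule (tateDual localTatePairingZMod
  SelmerStructure)
open Literature.NumberTheory.GaloisRepresentations.DiscreteGaloisModule.TorsionLayers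
open Literature.NumberTheory.IwasawaTheory.Greenberg2016
open _root_.ContinuousCohomology

variable {K : Type} [Field K] [NumberField K] {S : Set (HeightOneSpectrum (𝓞 K))} [Finite (SigmaPlace S)]
  {Λ : Type} [CommRing Λ] [TopologicalSpace Λ]
  {D : Type} [AddCommGroup D] [Module Λ D] [TopologicalSpace D] [DiscreteTopology D]
  [ContinuousSMul Λ D]
  (ρ : ContinuousRep (GaloisGroupUnramifiedOutside K S) Λ D) (L : Specification S ρ)
  {p : ℕ} [Fact p.Prime]

/-- **Greenberg 2010, Prop. 3.2.1, step (ε), assembled: «every thread of the canonical dual Selmer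
tower is zero ⟹ SUR(𝐃, 𝓛)».**  For a continuous `Λ`-linear `Gal(K_Σ/K)`-module `𝐃` exhausted by finite
stable `Λ`-levels `N k` with `p^k · N k = 0`, `Σ = T` (all archimedean places, the finite ones being
`S ∋ {v ∣ p}`), and the level Selmer structures `𝓕_m` induced by the specification `𝓛` (preimage of
`L(K_v, 𝐃)` on `Σ`, unramified off `Σ`): if for every `m₀` every one-step-compatible thread
`(y_j ∈ H¹_{𝓕_{m₀+j}^*}(K, Hom(N (m₀+j), μ_{p^{m₀+j}})))_j` (canonical local invariants) vanishes, then
`φ_𝓛 : H¹(K_Σ/K, 𝐃) → Q_𝓛(K, 𝐃)` is surjective.  Proof: common finite level of representatives (B3)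
→ Kőnig step (C6b) → finite-level Poitou–Tate lift (C6a).
[cite: Greenberg2010, Prop. 3.2.1 (p. 15) and Prop. 3.1.1 (p. 14)] [cite: MilneADT2006, Ch. I, Thm. 4.10 (b)]
[cite: SerreGaloisCohomology1997, I §2.2 Prop. 8] -/
theorem sur_of_forall_threads_eq_zero
    (hSp : ∀ v : HeightOneSpectrum (𝓞 K), ((p : ℕ) : 𝓞 K) ∈ v.asIdeal → v ∈ S)
    -- the finite `Λ`-levels
    (N : ℕ → Submodule Λ D) (hmono : Monotone N)
    (hN : ∀ (k : ℕ) (g : GaloisGroupUnramifiedOutside K S), N k ≤ (N k).comap (ρ g))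
    (htors : ∀ (k : ℕ), ∀ d ∈ N k, (p ^ k) • d = 0) (hfin : ∀ k, Finite (N k))
    (hex : ∀ d : D, ∃ k, d ∈ N k)
    -- `Σ` as a Finset of places
    (T : Finset (Place K)) (hTinl : ∀ w : InfinitePlace K, (Sum.inl w : Place K) ∈ T)
    (hTinr : ∀ v : HeightOneSpectrum (𝓞 K), (Sum.inr v : Place K) ∈ T ↔ v ∈ S)
    -- «lim_m H¹_{𝓕_m^*}(K, Hom(N m, μ_{p^m})) = 0» from every level `m₀` on
    (hlim : haveI := (lambdaTorsionLayers S ρ p N hmono hN htors hfin hex).finite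
      ∀ (m₀ : ℕ) (y : ∀ j : ℕ, galoisCohomology
        (((lambdaTorsionLayers S ρ p N hmono hN htors hfin hex).layerRep (m₀ + j)).tateDual
          (p ^ (m₀ + j))) 1),
      (∀ j, y j ∈ ((LocalInvariants.canonical K (p ^ (m₀ + j))).dualSelmerStructure
        ((lambdaTorsionLayers S ρ p N hmono hN htors hfin hex).layerRep (m₀ + j))
        ((lambdaTorsionLayers S ρ p N hmono hN htors hfin hex).levelSelmerStructure
          (specSelmerStructure S ρ L) T (m₀ + j))).selmerGroup) →
      (∀ j, cohomologyMap ((lambdaTorsionLayers S ρ p N hmono hN htors hfin hex).dualSystem.redHom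
        (Nat.le_succ (m₀ + j))) 1 (y (j + 1)) = y j) →
      ∀ j, y j = 0) :
    L.SUR := by
  classical
  haveI hp0 : NeZero p := ⟨(Fact.out : p.Prime).ne_zero⟩
  haveI hfinE : ∀ k, Finite ((lambdaTorsionLayers S ρ p N hmono hN htors hfin hex).N k) :=
    fun k => hfin k
  intro q
  -- (1) representatives of the coordinates of `q`, all from one finite level `N i`
  choose t ht using fun v : SigmaPlace S => Submodule.Quotient.mk_surjective (L v.1) (q v)
  obtain ⟨i, t', ht'⟩ := exists_level_forall_localHmap_eq S ρ N hN hmono.directed_le hex t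
  -- the corresponding local classes of the `Γ_K`-module `N i` (zero off `Σ`)
  obtain ⟨s, hs⟩ : ∃ s : ∀ v : Place K, galoisCohomology
      (((lambdaTorsionLayers S ρ p N hmono hN htors hfin hex).layerRep i).toLocal v) 1,
      ∀ v : SigmaPlace S, localHAddEquiv S (ρ.subrepresentation (N i) (hN i)) v.1 1 (s v.1) = t' v := by
    refine ⟨fun v => if h : InSigma S v then
      (localHAddEquiv S (ρ.subrepresentation (N i) (hN i)) v 1).symm (t' ⟨v, h⟩) else 0, fun v => ?_⟩
    simp only [dif_pos v.2]
    exact AddEquiv.apply_symm_apply _ _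
  -- (2) the Kőnig step: the obstruction vanishes identically at some level `m ≥ i`
  have hTp : ∀ v : HeightOneSpectrum (𝓞 K), ((p : ℕ) : 𝓞 K) ∈ v.asIdeal → (Sum.inr v : Place K) ∈ T :=
    fun v h => (hTinr v).2 (hSp v h)
  have hur : ∀ (k : ℕ) (v : HeightOneSpectrum (𝓞 K)), (Sum.inr v : Place K) ∉ T →
      GaloisRep.IsUnramifiedAt v ((lambdaTorsionLayers S ρ p N hmono hN htors hfin hex).layerRep k) :=
    fun k v hv => isUnramifiedAt_layerRep_lambdaTorsionLayers S ρ p N hmono hN htors hfin hex k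
      fun h => hv ((hTinr v).2 h)
  obtain ⟨m, hm, hvan⟩ := exists_level_obstruction_eq_zero
    (lambdaTorsionLayers S ρ p N hmono hN htors hfin hex) T hTp hur
    (fun m => (lambdaTorsionLayers S ρ p N hmono hN htors hfin hex).levelSelmerStructure
      (specSelmerStructure S ρ L) T m)
    (fun m => (lambdaTorsionLayers S ρ p N hmono hN htors hfin hex).isUnramifiedOutside_levelSelmerStructure
      (specSelmerStructure S ρ L) hTinl m)
    ((lambdaTorsionLayers S ρ p N hmono hN htors hfin hex).map_layerInclHom_mem_levelSelmerStructure
      (specSelmerStructure S ρ L) hTinl)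
    i s (hlim i)
  -- (3) the finite-level Poitou–Tate lift at level `N m`, `n = p^m`
  haveI : Finite (N m) := hfin m
  have hSn : ∀ v : HeightOneSpectrum (𝓞 K), ((p ^ m : ℕ) : 𝓞 K) ∈ v.asIdeal → v ∈ S := by
    intro v h
    refine hSp v (v.isPrime.mem_of_pow_mem m ?_)
    rwa [← Nat.cast_pow]
  -- the pushed-forward local classes at level `m` represent `q`
  have hs' : ∀ v : SigmaPlace S,
      Submodule.Quotient.mk (p := L v.1)
        (Hmap (localRep S (ρ.subrepresentation (N m) (hN m)) v.1) (localRep S ρ v.1) (N m).subtypeL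
          (fun _ _ ↦ rfl) 1 (localHAddEquiv S (ρ.subrepresentation (N m) (hN m)) v.1 1
            ((lambdaTorsionLayers S ρ p N hmono hN htors hfin hex).localInclMap v.1 hm (s v.1)))) =
        q v := by
    intro v
    rw [localHAddEquiv_localInclMap, hs v,
      localHmap_subtype_localHmap_inclusion S ρ N hN v.1 (hmono hm) 1 (Or.inl rfl), ht' v, ht v]
  obtain ⟨x, hx⟩ := exists_phi_eq_of_level ρ L hSn (N m) (hN m)
    (pow_smul_eq_zero_of_level p N htors m) T hTinl hTinr
    ((lambdaTorsionLayers S ρ p N hmono hN htors hfin hex).levelSelmerStructure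
      (specSelmerStructure S ρ L) T m)
    ((lambdaTorsionLayers S ρ p N hmono hN htors hfin hex).levelSelmerStructure ⊤ T m)
    (fun v hv z => ((lambdaTorsionLayers S ρ p N hmono hN htors hfin hex).mem_levelSelmerStructure_iff
        (specSelmerStructure S ρ L) m hv z).trans
      (localSubtypeMap_mem_specSelmerStructure_iff S ρ p N hmono hN htors hfin hex L v m z))
    ((lambdaTorsionLayers S ρ p N hmono hN htors hfin hex).isUnramifiedOutside_levelSelmerStructure
      (specSelmerStructure S ρ L) hTinl m)
    (fun v hv => (lambdaTorsionLayers S ρ p N hmono hN htors hfin hex).levelSelmerStructure_top_of_mem m hv)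
    ((lambdaTorsionLayers S ρ p N hmono hN htors hfin hex).isUnramifiedOutside_levelSelmerStructure
      ⊤ hTinl m)
    q (fun v => (lambdaTorsionLayers S ρ p N hmono hN htors hfin hex).localInclMap v hm (s v)) hs'
    hvan
  exact ⟨x, hx⟩

end Summit.BirchSwinnertonDyer.BirchSwinnertonDyer.Theorems.SurLambda
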